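import Literature.Topology.FourManifolds.KhInsertChord
import Literature.Topology.FourManifolds.KhFlipReach
import Literature.Topology.FourManifolds.KhResolutionsProofs
import Literature.Topology.FourManifolds.KhResolutionsParityProofs
import HarnessLib

/-!
# The bigon of the second Reidemeister move on a Gauss diagram

Sibling file of `KhComplex.lean`, a brick of the invariance programme for
`Literature.Topology.FourManifolds.GaussDiagram.nonempty_iso_khovanovHomology_of_equiv`
(Khovanov (2000), Thm. 1), opening the second Reidemeister move (Khovanov (2000), §5.3;
Bar-Natan (2002), §4). The target of `PolyakMove.omega2a` is a double chord insertion: two new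
chords `x` (index `n`, sign `ε`) and `y` (index `n + 1`, sign `-ε`) whose over-passages are
adjacent (`x` first) and whose under-passages are adjacent (`x` first). Up to a rotation of the
base point one of the two pairs sits at the two last positions; this file fixes that normal form,

* `G.bigon m tf ε` — the pair of over-passages (`tf = true`) or of under-passages
  (`tf = false`) at the positions `m, m + 1` (`m ≤ 2n`), the other pair at `2n + 2, 2n + 3`;
  it is a Polyak move away from `G` (`polyakMove_bigon`);

and records its bookkeeping: passages, chords, partners, signs, states
(`bigonState σ a b = Fin.snoc (Fin.snoc σ a) b`), Seifert rules and Koszul signs of the two new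
chords, the six arcs around the new points — in particular the two **sides of the bigon**
`sideM` (from `m` to `m + 1`) and `sideE` (from `2n + 2` to `2n + 3`) — and the gluing clauses at
the four new points. The main results concern the resolution in which *neither* new chord is
smoothed à la Seifert (`x` and `y` have opposite signs, so this is the resolution reached from
the all-`0` resolution by flipping the positive one of `x, y`):

* `inO_iff_of_adj` — **there the two sides of the bigon form a state circle by themselves**
  (the small circle `O` of Khovanov (2000), §5.3, Fig. 21 / Bar-Natan (2002), §4.3: the set
  `{sideM, sideE}` is closed under the reconnection relation, and `sideM ~ sideE`);
* `isSplitAt_stA`, `isMergeAt_stO` — **flipping the positive new chord from the all-`0`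
  resolution of `x, y` splits off `O`, and then flipping the negative one merges `O` back**,
  for every Gauss diagram `G` and every state of the old chords (no planarity needed: the
  bigon is local).

No named fact is introduced.

## References

* M. Khovanov, *A categorification of the Jones polynomial*, Duke Math. J. 101 (2000) 359–426,
  §5.3 (invariance under the second move). [cite: Khovanov2000, §5.3]
* D. Bar-Natan, *On Khovanov's categorification of the Jones polynomial*, Algebr. Geom. Topol. 2
  (2002) 337–370, §4.3. [cite: BarNatan2002, §4]
* M. Polyak, *Minimal generating sets of Reidemeister moves*, Quantum Topol. 1 (2010), §2
  (the move `Ω2a` on Gauss diagrams). [cite: Polyak2010, §2]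
-/

open Function

noncomputable section

namespace Literature.Topology.FourManifolds

namespace GaussDiagram

/-! ## Values of `Fin.succAbove` and of the embedding of old points -/

/-- The value of `Fin.succAbove`. [folklore] -/
theorem val_succAbove {k : ℕ} (p : Fin (k + 1)) (i : Fin k) :
    (p.succAbove i : ℕ) = if i.val < p.val then i.val else i.val + 1 := by
  split_ifs with h
  · rw [Fin.succAbove_of_castSucc_lt p i (Fin.lt_def.2 (by simpa using h))]
    simp
  · rw [Fin.succAbove_of_le_castSucc p i (Fin.le_def.2 (by simpa using Nat.le_of_not_lt h))]
    simp [Fin.val_succ]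

/-- The value of an embedded old point, in general position. [folklore] -/
theorem val_insEmb (G : GaussDiagram) (o : Fin (2 * G.n + 2)) (u : Fin (2 * G.n + 1))
    (q : Fin (2 * G.n)) :
    (G.insEmb o u q : ℕ) =
      if (if q.val < u.val then q.val else q.val + 1) < o.val then
        (if q.val < u.val then q.val else q.val + 1)
      else (if q.val < u.val then q.val else q.val + 1) + 1 := by
  unfold insEmb
  rw [val_succAbove, val_succAbove]

variable (G : GaussDiagram) (m : Fin (2 * G.n + 1)) (tf : Bool) (ε : ℤˣ)

/-! ## The bigon -/

/-- Over-passage of the first new chord in the intermediate diagram. [folklore] -/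
def bigonO₁ : Fin (2 * G.n + 2) := if tf then m.castSucc else Fin.last (2 * G.n + 1)

/-- Under-passage parameter of the first new chord in the intermediate diagram. [folklore] -/
def bigonU₁ : Fin (2 * G.n + 1) := if tf then Fin.last (2 * G.n) else m

/-- The intermediate diagram: `G` with the first new chord `x` inserted. [folklore] -/
def bigonMid : GaussDiagram := G.insertChord (G.bigonO₁ m tf) (G.bigonU₁ m tf) ε

/-- The intermediate diagram has one more chord. [folklore] -/
@[simp] theorem bigonMid_n : (G.bigonMid m tf ε).n = G.n + 1 := rfl

/-- The position `m + 1` among the parameters of the second insertion. [folklore] -/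
def bigonM' : Fin (2 * (G.bigonMid m tf ε).n + 1) := ⟨m.val + 1, by rw [bigonMid_n]; omega⟩

/-- The value of `bigonM'`. [folklore] -/
@[simp] theorem val_bigonM' : (G.bigonM' m tf ε : ℕ) = m.val + 1 := rfl

/-- Over-passage of the second new chord. [folklore] -/
def bigonO₂ : Fin (2 * (G.bigonMid m tf ε).n + 2) :=
  if tf then (G.bigonM' m tf ε).castSucc else Fin.last (2 * (G.bigonMid m tf ε).n + 1)

/-- Under-passage parameter of the second new chord. [folklore] -/
def bigonU₂ : Fin (2 * (G.bigonMid m tf ε).n + 1) :=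
  if tf then Fin.last (2 * (G.bigonMid m tf ε).n) else G.bigonM' m tf ε

/-- **The bigon of the second Reidemeister move** in normal position: two new chords `x` (index
`n`, sign `ε`) and `y` (index `n + 1`, sign `-ε`); for `tf = true` the over-passages of `x, y`
are at `m, m + 1` and the under-passages at `2n + 2, 2n + 3`, for `tf = false` the other way
round. This is the target `(G.insertChord o u ε).insertChord o' u' (-ε)` of
`PolyakMove.omega2a` for these positions (`polyakMove_bigon`). Polyak (2010), §2 (`Ω2a`);
Khovanov (2000), §5.3. [cite: Polyak2010, §2] -/
def bigon : GaussDiagram :=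
  (G.bigonMid m tf ε).insertChord (G.bigonO₂ m tf ε) (G.bigonU₂ m tf ε) (-ε)

/-- The bigon has two more chords. [folklore] -/
@[simp] theorem bigon_n : (G.bigon m tf ε).n = G.n + 2 := rfl

/-- The first embedding of old points: `q ↦ q` below `m`, `q ↦ q + 1` from `m` on. [folklore] -/
theorem val_insEmb_bigon₁ (q : Fin (2 * G.n)) :
    (G.insEmb (G.bigonO₁ m tf) (G.bigonU₁ m tf) q : ℕ) =
      if q.val < m.val then q.val else q.val + 1 := by
  rw [val_insEmb]
  have hq := q.isLt
  have hm := m.isLt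
  cases tf
  · simp only [bigonO₁, bigonU₁, Bool.false_eq_true, ↓reduceIte, Fin.val_last]
    split_ifs <;> omega
  · simp only [bigonO₁, bigonU₁, ↓reduceIte, Fin.val_last, Fin.val_castSucc]
    split_ifs <;> omega

/-- The second embedding of old points: `p ↦ p` below `m + 1`, `p ↦ p + 1` from `m + 1` on.
[folklore] -/
theorem val_insEmb_bigon₂ (p : Fin (2 * (G.bigonMid m tf ε).n)) :
    ((G.bigonMid m tf ε).insEmb (G.bigonO₂ m tf ε) (G.bigonU₂ m tf ε) p : ℕ) =
      if p.val < m.val + 1 then p.val else p.val + 1 := by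
  rw [val_insEmb]
  have hp : p.val < 2 * G.n + 2 := by have := p.isLt; simp only [bigonMid_n] at this; omega
  have hm := m.isLt
  cases tf
  · simp only [bigonO₂, bigonU₂, Bool.false_eq_true, ↓reduceIte, Fin.val_last, bigonMid_n,
      val_bigonM']
    split_ifs <;> omega
  · simp only [bigonO₂, bigonU₂, ↓reduceIte, Fin.val_last, Fin.val_castSucc, bigonMid_n,
      val_bigonM']
    split_ifs <;> omega

/-! ## Chords and passages of the bigon -/

/-- The index of an old chord in the bigon (written so as to match the lemmas of
`KhInsertChord` for both insertions). [folklore] -/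
def oldC (i : Fin G.n) : Fin (G.bigon m tf ε).n :=
  @Fin.castSucc (G.bigonMid m tf ε).n (@Fin.castSucc G.n i)

/-- The index of the first new chord `x`. [folklore] -/
def bX : Fin (G.bigon m tf ε).n := @Fin.castSucc (G.bigonMid m tf ε).n (Fin.last G.n)

/-- The index of the second new chord `y`. [folklore] -/
def bY : Fin (G.bigon m tf ε).n := Fin.last (G.bigonMid m tf ε).n

/-- The value of the index of an old chord. [folklore] -/
@[simp] theorem val_oldC (i : Fin G.n) : (G.oldC m tf ε i : ℕ) = i := rfl

/-- The value of the index of `x`. [folklore] -/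
@[simp] theorem val_bX : (G.bX m tf ε : ℕ) = G.n := rfl

/-- The value of the index of `y`. [folklore] -/
@[simp] theorem val_bY : (G.bY m tf ε : ℕ) = G.n + 1 := rfl

/-- `oldC` is injective. [folklore] -/
@[simp] theorem oldC_inj {i j : Fin G.n} : G.oldC m tf ε i = G.oldC m tf ε j ↔ i = j := by
  constructor
  · intro h
    exact Fin.ext (by simpa using congrArg Fin.val h)
  · rintro rfl
    rfl

/-- `x ≠ y`. [folklore] -/
theorem bX_ne_bY : G.bX m tf ε ≠ G.bY m tf ε := fun h ↦ by
  have := congrArg Fin.val h; simp at this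

/-- An old chord is not `x`. [folklore] -/
theorem oldC_ne_bX (i : Fin G.n) : G.oldC m tf ε i ≠ G.bX m tf ε := fun h ↦ by
  have := congrArg Fin.val h; simp at this; omega

/-- An old chord is not `y`. [folklore] -/
theorem oldC_ne_bY (i : Fin G.n) : G.oldC m tf ε i ≠ G.bY m tf ε := fun h ↦ by
  have := congrArg Fin.val h; simp at this; omega

/-- Every chord of the bigon is an old chord, `x` or `y`. [folklore] -/
theorem eq_oldC_or_bX_or_bY (j : Fin (G.bigon m tf ε).n) :
    (∃ i : Fin G.n, j = G.oldC m tf ε i) ∨ j = G.bX m tf ε ∨ j = G.bY m tf ε := by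
  rcases Fin.eq_castSucc_or_eq_last j with ⟨j', rfl⟩ | rfl
  · rcases Fin.eq_castSucc_or_eq_last j' with ⟨i, rfl⟩ | rfl
    · exact Or.inl ⟨i, rfl⟩
    · exact Or.inr (Or.inl rfl)
  · exact Or.inr (Or.inr rfl)

/-- The sign of `x` is `ε`. [folklore] -/
@[simp] theorem sign_bigon_bX : (G.bigon m tf ε).sign (G.bX m tf ε) = ε :=
  ((G.bigonMid m tf ε).insertChord_sign_castSucc _ _ (-ε) (Fin.last G.n)).trans
    (G.insertChord_sign_last _ _ ε)

/-- The sign of `y` is `-ε`. [folklore] -/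
@[simp] theorem sign_bigon_bY : (G.bigon m tf ε).sign (G.bY m tf ε) = -ε :=
  (G.bigonMid m tf ε).insertChord_sign_last _ _ (-ε)

/-- Old chords keep their signs. [folklore] -/
@[simp] theorem sign_bigon_oldC (i : Fin G.n) :
    (G.bigon m tf ε).sign (G.oldC m tf ε i) = G.sign i :=
  ((G.bigonMid m tf ε).insertChord_sign_castSucc _ _ (-ε) i.castSucc).trans
    (G.insertChord_sign_castSucc _ _ ε i)

/-- The over-passage of `x`: `m` (`tf = true`) or `2n + 2`. [folklore] -/
theorem val_overPos_bigon_bX :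
    ((G.bigon m tf ε).overPos (G.bX m tf ε) : ℕ) = if tf then m.val else 2 * G.n + 2 := by
  have h1 : (G.bigon m tf ε).overPos (G.bX m tf ε) = (G.bigonMid m tf ε).insEmb (G.bigonO₂ m tf ε)
      (G.bigonU₂ m tf ε) ((G.bigonMid m tf ε).overPos (Fin.last G.n)) :=
    (G.bigonMid m tf ε).insertChord_overPos_castSucc_eq _ _ (-ε) (Fin.last G.n)
  have h2 : (G.bigonMid m tf ε).overPos (Fin.last G.n) = G.bigonO₁ m tf :=
    G.insertChord_overPos_last _ _ ε
  rw [h1, val_insEmb_bigon₂, h2]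
  have hm := m.isLt
  cases tf
  · simp only [bigonO₁, Bool.false_eq_true, ↓reduceIte, Fin.val_last]
    split_ifs <;> omega
  · simp only [bigonO₁, ↓reduceIte, Fin.val_castSucc]
    split_ifs <;> omega

/-- The under-passage of `x`: `2n + 2` (`tf = true`) or `m`. [folklore] -/
theorem val_underPos_bigon_bX :
    ((G.bigon m tf ε).underPos (G.bX m tf ε) : ℕ) = if tf then 2 * G.n + 2 else m.val := by
  have h1 : (G.bigon m tf ε).underPos (G.bX m tf ε) = (G.bigonMid m tf ε).insEmb (G.bigonO₂ m tf ε)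
      (G.bigonU₂ m tf ε) ((G.bigonMid m tf ε).underPos (Fin.last G.n)) :=
    (G.bigonMid m tf ε).insertChord_underPos_castSucc_eq _ _ (-ε) (Fin.last G.n)
  have h2 : (G.bigonMid m tf ε).underPos (Fin.last G.n) =
      (G.bigonO₁ m tf).succAbove (G.bigonU₁ m tf) :=
    G.insertChord_underPos_last _ _ ε
  rw [h1, val_insEmb_bigon₂, h2, val_succAbove]
  have hm := m.isLt
  cases tf
  · simp only [bigonO₁, bigonU₁, Bool.false_eq_true, ↓reduceIte, Fin.val_last]
    split_ifs <;> omega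
  · simp only [bigonO₁, bigonU₁, ↓reduceIte, Fin.val_last, Fin.val_castSucc]
    split_ifs <;> omega

/-- The over-passage of `y`: `m + 1` (`tf = true`) or `2n + 3`. [folklore] -/
theorem val_overPos_bigon_bY :
    ((G.bigon m tf ε).overPos (G.bY m tf ε) : ℕ) = if tf then m.val + 1 else 2 * G.n + 3 := by
  have h1 : (G.bigon m tf ε).overPos (G.bY m tf ε) = G.bigonO₂ m tf ε :=
    (G.bigonMid m tf ε).insertChord_overPos_last _ _ (-ε)
  rw [h1]
  cases tf
  · simp only [bigonO₂, Bool.false_eq_true, ↓reduceIte, Fin.val_last, bigonMid_n]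
    omega
  · simp only [bigonO₂, ↓reduceIte, Fin.val_castSucc, val_bigonM']

/-- The under-passage of `y`: `2n + 3` (`tf = true`) or `m + 1`. [folklore] -/
theorem val_underPos_bigon_bY :
    ((G.bigon m tf ε).underPos (G.bY m tf ε) : ℕ) = if tf then 2 * G.n + 3 else m.val + 1 := by
  have h1 : (G.bigon m tf ε).underPos (G.bY m tf ε) =
      (G.bigonO₂ m tf ε).succAbove (G.bigonU₂ m tf ε) :=
    (G.bigonMid m tf ε).insertChord_underPos_last _ _ (-ε)
  rw [h1, val_succAbove]
  have hm := m.isLt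
  cases tf
  · simp only [bigonO₂, bigonU₂, Bool.false_eq_true, ↓reduceIte, Fin.val_last, bigonMid_n,
      val_bigonM']
    split_ifs <;> omega
  · simp only [bigonO₂, bigonU₂, ↓reduceIte, Fin.val_last, Fin.val_castSucc, bigonMid_n,
      val_bigonM']
    split_ifs <;> omega

/-- **The old passages are renumbered by `q ↦ q` below `m` and `q ↦ q + 2` from `m` on.**
[folklore] -/
theorem val_overPos_bigon_oldC (i : Fin G.n) :
    ((G.bigon m tf ε).overPos (G.oldC m tf ε i) : ℕ) =
      if (G.overPos i).val < m.val then (G.overPos i).val else (G.overPos i).val + 2 := by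
  have h1 : (G.bigon m tf ε).overPos (G.oldC m tf ε i) = (G.bigonMid m tf ε).insEmb
      (G.bigonO₂ m tf ε) (G.bigonU₂ m tf ε) ((G.bigonMid m tf ε).overPos i.castSucc) :=
    (G.bigonMid m tf ε).insertChord_overPos_castSucc_eq _ _ (-ε) i.castSucc
  have h2 : (G.bigonMid m tf ε).overPos i.castSucc =
      G.insEmb (G.bigonO₁ m tf) (G.bigonU₁ m tf) (G.overPos i) :=
    G.insertChord_overPos_castSucc_eq _ _ ε i
  rw [h1, val_insEmb_bigon₂, h2, val_insEmb_bigon₁]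
  split_ifs <;> omega

/-- See `val_overPos_bigon_oldC`. [folklore] -/
theorem val_underPos_bigon_oldC (i : Fin G.n) :
    ((G.bigon m tf ε).underPos (G.oldC m tf ε i) : ℕ) =
      if (G.underPos i).val < m.val then (G.underPos i).val else (G.underPos i).val + 2 := by
  have h1 : (G.bigon m tf ε).underPos (G.oldC m tf ε i) = (G.bigonMid m tf ε).insEmb
      (G.bigonO₂ m tf ε) (G.bigonU₂ m tf ε) ((G.bigonMid m tf ε).underPos i.castSucc) :=
    (G.bigonMid m tf ε).insertChord_underPos_castSucc_eq _ _ (-ε) i.castSucc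
  have h2 : (G.bigonMid m tf ε).underPos i.castSucc =
      G.insEmb (G.bigonO₁ m tf) (G.bigonU₁ m tf) (G.underPos i) :=
    G.insertChord_underPos_castSucc_eq _ _ ε i
  rw [h1, val_insEmb_bigon₂, h2, val_insEmb_bigon₁]
  split_ifs <;> omega

/-- **The bigon is a Polyak move away from `G`** (`PolyakMove.omega2a`: the over-passages of
`x, y` are adjacent, `x` first, and so are the under-passages). Polyak (2010), §2.
[cite: Polyak2010, §2] -/
theorem polyakMove_bigon : PolyakMove G (G.bigon m tf ε) := by
  refine PolyakMove.omega2a G (G.bigonO₁ m tf) (G.bigonU₁ m tf) (G.bigonO₂ m tf ε)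
    (G.bigonU₂ m tf ε) ε ?_ ?_
  · show ((G.bigon m tf ε).overPos (G.bY m tf ε) : ℕ) = (G.bigon m tf ε).overPos (G.bX m tf ε) + 1
    rw [val_overPos_bigon_bY, val_overPos_bigon_bX]
    cases tf <;> simp
  · show ((G.bigon m tf ε).underPos (G.bY m tf ε) : ℕ) =
      (G.bigon m tf ε).underPos (G.bX m tf ε) + 1
    rw [val_underPos_bigon_bY, val_underPos_bigon_bX]
    cases tf <;> simp

/-! ## The four new marked points and the embedding of the old ones -/

/-- A marked point of the bigon from its number. [folklore] -/
def bPos (k : ℕ) (hk : k < 2 * G.n + 4) : Fin (2 * (G.bigon m tf ε).n) :=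
  ⟨k, by rw [bigon_n]; omega⟩

/-- The value of `bPos`. [folklore] -/
@[simp] theorem val_bPos (k : ℕ) (hk : k < 2 * G.n + 4) : (G.bPos m tf ε k hk : ℕ) = k := rfl

/-- The new point `m` (passage of `x`). [folklore] -/
def posM : Fin (2 * (G.bigon m tf ε).n) := G.bPos m tf ε m.val (by omega)

/-- The new point `m + 1` (passage of `y`). [folklore] -/
def posM1 : Fin (2 * (G.bigon m tf ε).n) := G.bPos m tf ε (m.val + 1) (by omega)

/-- The new point `2n + 2` (passage of `x`). [folklore] -/
def posE : Fin (2 * (G.bigon m tf ε).n) := G.bPos m tf ε (2 * G.n + 2) (by omega)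

/-- The new point `2n + 3` (passage of `y`). [folklore] -/
def posE1 : Fin (2 * (G.bigon m tf ε).n) := G.bPos m tf ε (2 * G.n + 3) (by omega)

/-- **The embedding of the old marked points**: `q ↦ q` below `m`, `q ↦ q + 2` from `m` on.
[folklore] -/
def bEmb (q : Fin (2 * G.n)) : Fin (2 * (G.bigon m tf ε).n) :=
  G.bPos m tf ε (if q.val < m.val then q.val else q.val + 2)
    (by have := q.isLt; split_ifs <;> omega)

/-- The value of `posM`. [folklore] -/
@[simp] theorem val_posM : (G.posM m tf ε : ℕ) = m.val := rfl

/-- The value of `posM1`. [folklore] -/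
@[simp] theorem val_posM1 : (G.posM1 m tf ε : ℕ) = m.val + 1 := rfl

/-- The value of `posE`. [folklore] -/
@[simp] theorem val_posE : (G.posE m tf ε : ℕ) = 2 * G.n + 2 := rfl

/-- The value of `posE1`. [folklore] -/
@[simp] theorem val_posE1 : (G.posE1 m tf ε : ℕ) = 2 * G.n + 3 := rfl

/-- The value of an embedded old point. [folklore] -/
@[simp] theorem val_bEmb (q : Fin (2 * G.n)) :
    (G.bEmb m tf ε q : ℕ) = if q.val < m.val then q.val else q.val + 2 := rfl

/-- The over-passage of `x` is `posM` or `posE`. [folklore] -/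
theorem overPos_bigon_bX :
    (G.bigon m tf ε).overPos (G.bX m tf ε) = if tf then G.posM m tf ε else G.posE m tf ε := by
  apply Fin.ext; rw [val_overPos_bigon_bX]; cases tf <;> rfl

/-- The under-passage of `x` is `posE` or `posM`. [folklore] -/
theorem underPos_bigon_bX :
    (G.bigon m tf ε).underPos (G.bX m tf ε) = if tf then G.posE m tf ε else G.posM m tf ε := by
  apply Fin.ext; rw [val_underPos_bigon_bX]; cases tf <;> rfl

/-- The over-passage of `y` is `posM1` or `posE1`. [folklore] -/
theorem overPos_bigon_bY :
    (G.bigon m tf ε).overPos (G.bY m tf ε) = if tf then G.posM1 m tf ε else G.posE1 m tf ε := by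
  apply Fin.ext; rw [val_overPos_bigon_bY]; cases tf <;> rfl

/-- The under-passage of `y` is `posE1` or `posM1`. [folklore] -/
theorem underPos_bigon_bY :
    (G.bigon m tf ε).underPos (G.bY m tf ε) = if tf then G.posE1 m tf ε else G.posM1 m tf ε := by
  apply Fin.ext; rw [val_underPos_bigon_bY]; cases tf <;> rfl

/-- Old over-passages are embedded old points. [folklore] -/
@[simp] theorem overPos_bigon_oldC (i : Fin G.n) :
    (G.bigon m tf ε).overPos (G.oldC m tf ε i) = G.bEmb m tf ε (G.overPos i) :=
  Fin.ext (G.val_overPos_bigon_oldC m tf ε i)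

/-- Old under-passages are embedded old points. [folklore] -/
@[simp] theorem underPos_bigon_oldC (i : Fin G.n) :
    (G.bigon m tf ε).underPos (G.oldC m tf ε i) = G.bEmb m tf ε (G.underPos i) :=
  Fin.ext (G.val_underPos_bigon_oldC m tf ε i)

/-- The chord through `posM` is `x`. [folklore] -/
@[simp] theorem chordOf_posM : (G.bigon m tf ε).chordOf (G.posM m tf ε) = G.bX m tf ε := by
  cases tf
  · have h := (G.bigon m false ε).chordOf_underPos (G.bX m false ε)
    rwa [underPos_bigon_bX] at h
  · have h := (G.bigon m true ε).chordOf_overPos (G.bX m true ε)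
    rwa [overPos_bigon_bX] at h

/-- The chord through `posE` is `x`. [folklore] -/
@[simp] theorem chordOf_posE : (G.bigon m tf ε).chordOf (G.posE m tf ε) = G.bX m tf ε := by
  cases tf
  · have h := (G.bigon m false ε).chordOf_overPos (G.bX m false ε)
    rwa [overPos_bigon_bX] at h
  · have h := (G.bigon m true ε).chordOf_underPos (G.bX m true ε)
    rwa [underPos_bigon_bX] at h

/-- The chord through `posM1` is `y`. [folklore] -/
@[simp] theorem chordOf_posM1 : (G.bigon m tf ε).chordOf (G.posM1 m tf ε) = G.bY m tf ε := by
  cases tf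
  · have h := (G.bigon m false ε).chordOf_underPos (G.bY m false ε)
    rwa [underPos_bigon_bY] at h
  · have h := (G.bigon m true ε).chordOf_overPos (G.bY m true ε)
    rwa [overPos_bigon_bY] at h

/-- The chord through `posE1` is `y`. [folklore] -/
@[simp] theorem chordOf_posE1 : (G.bigon m tf ε).chordOf (G.posE1 m tf ε) = G.bY m tf ε := by
  cases tf
  · have h := (G.bigon m false ε).chordOf_overPos (G.bY m false ε)
    rwa [overPos_bigon_bY] at h
  · have h := (G.bigon m true ε).chordOf_underPos (G.bY m true ε)
    rwa [underPos_bigon_bY] at h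

/-- The partner of `posM` is `posE`. [folklore] -/
@[simp] theorem partner_posM : (G.bigon m tf ε).partner (G.posM m tf ε) = G.posE m tf ε := by
  cases tf
  · have h := (G.bigon m false ε).partner_underPos (G.bX m false ε)
    rwa [underPos_bigon_bX, overPos_bigon_bX] at h
  · have h := (G.bigon m true ε).partner_overPos (G.bX m true ε)
    rwa [underPos_bigon_bX, overPos_bigon_bX] at h

/-- The partner of `posE` is `posM`. [folklore] -/
@[simp] theorem partner_posE : (G.bigon m tf ε).partner (G.posE m tf ε) = G.posM m tf ε := by
  rw [← partner_posM, partner_partner]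

/-- The partner of `posM1` is `posE1`. [folklore] -/
@[simp] theorem partner_posM1 : (G.bigon m tf ε).partner (G.posM1 m tf ε) = G.posE1 m tf ε := by
  cases tf
  · have h := (G.bigon m false ε).partner_underPos (G.bY m false ε)
    rwa [underPos_bigon_bY, overPos_bigon_bY] at h
  · have h := (G.bigon m true ε).partner_overPos (G.bY m true ε)
    rwa [underPos_bigon_bY, overPos_bigon_bY] at h

/-- The partner of `posE1` is `posM1`. [folklore] -/
@[simp] theorem partner_posE1 : (G.bigon m tf ε).partner (G.posE1 m tf ε) = G.posM1 m tf ε := by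
  rw [← partner_posM1, partner_partner]

/-- The chord through an embedded old point is the old chord. [folklore] -/
@[simp] theorem chordOf_bEmb (q : Fin (2 * G.n)) :
    (G.bigon m tf ε).chordOf (G.bEmb m tf ε q) = G.oldC m tf ε (G.chordOf q) := by
  obtain ⟨i, rfl | rfl⟩ := G.exists_chord q
  · rw [G.chordOf_overPos, ← overPos_bigon_oldC, chordOf_overPos]
  · rw [G.chordOf_underPos, ← underPos_bigon_oldC, chordOf_underPos]

/-- The partner of an embedded old point is the embedded old partner. [folklore] -/
@[simp] theorem partner_bEmb (q : Fin (2 * G.n)) :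
    (G.bigon m tf ε).partner (G.bEmb m tf ε q) = G.bEmb m tf ε (G.partner q) := by
  obtain ⟨i, rfl | rfl⟩ := G.exists_chord q
  · rw [G.partner_overPos, ← overPos_bigon_oldC, partner_overPos, underPos_bigon_oldC]
  · rw [G.partner_underPos, ← underPos_bigon_oldC, partner_underPos, overPos_bigon_oldC]

/-- Every marked point of the bigon is an embedded old point or one of the four new points.
[folklore] -/
theorem eq_bEmb_or (p : Fin (2 * (G.bigon m tf ε).n)) :
    (∃ q, p = G.bEmb m tf ε q) ∨ p = G.posM m tf ε ∨ p = G.posM1 m tf ε ∨ p = G.posE m tf ε ∨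
      p = G.posE1 m tf ε := by
  have hp : p.val < 2 * G.n + 4 := by have := p.isLt; simp only [bigon_n] at this; omega
  have hm := m.isLt
  by_cases h1 : p.val < m.val
  · exact Or.inl ⟨⟨p.val, by omega⟩, Fin.ext (by simp [h1])⟩
  by_cases h2 : p.val = m.val
  · exact Or.inr (Or.inl (Fin.ext h2))
  by_cases h3 : p.val = m.val + 1
  · exact Or.inr (Or.inr (Or.inl (Fin.ext h3)))
  by_cases h4 : p.val < 2 * G.n + 2
  · refine Or.inl ⟨⟨p.val - 2, by omega⟩, Fin.ext ?_⟩
    simp only [val_bEmb]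
    rw [if_neg (by simp only [not_lt]; omega)]
    omega
  by_cases h5 : p.val = 2 * G.n + 2
  · exact Or.inr (Or.inr (Or.inr (Or.inl (Fin.ext h5))))
  · exact Or.inr (Or.inr (Or.inr (Or.inr (Fin.ext (by simp only [val_posE1]; omega)))))

/-! ## States of the bigon: `Fin.snoc (Fin.snoc σ a) b` -/

/-- The state of the bigon with old smoothings `σ` and smoothings `a`, `b` of `x`, `y`.
[folklore] -/
def bigonState (σ : G.State) (a b : Bool) : (G.bigon m tf ε).State :=
  Fin.snoc (Fin.snoc σ a) b

/-- A state of the bigon at an old chord. [folklore] -/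
@[simp] theorem bigonState_oldC (σ : G.State) (a b : Bool) (i : Fin G.n) :
    G.bigonState m tf ε σ a b (G.oldC m tf ε i) = σ i := by
  unfold bigonState oldC
  rw [Fin.snoc_castSucc, Fin.snoc_castSucc]

/-- A state of the bigon at `x`. [folklore] -/
@[simp] theorem bigonState_bX (σ : G.State) (a b : Bool) :
    G.bigonState m tf ε σ a b (G.bX m tf ε) = a := by
  unfold bigonState bX
  rw [Fin.snoc_castSucc, Fin.snoc_last]

/-- A state of the bigon at `y`. [folklore] -/
@[simp] theorem bigonState_bY (σ : G.State) (a b : Bool) :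
    G.bigonState m tf ε σ a b (G.bY m tf ε) = b := by
  unfold bigonState bY
  rw [Fin.snoc_last]

/-- Every state of the bigon is a `bigonState`. [folklore] -/
theorem eq_bigonState (τ : (G.bigon m tf ε).State) :
    τ = G.bigonState m tf ε (fun i ↦ τ (G.oldC m tf ε i)) (τ (G.bX m tf ε)) (τ (G.bY m tf ε)) := by
  funext j
  rcases G.eq_oldC_or_bX_or_bY m tf ε j with ⟨i, rfl⟩ | rfl | rfl
  · rw [bigonState_oldC]
  · rw [bigonState_bX]
  · rw [bigonState_bY]

/-- `bigonState` is injective. [folklore] -/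
theorem bigonState_inj {σ σ' : G.State} {a a' b b' : Bool}
    (h : G.bigonState m tf ε σ a b = G.bigonState m tf ε σ' a' b') :
    σ = σ' ∧ a = a' ∧ b = b' := by
  refine ⟨funext fun i ↦ ?_, ?_, ?_⟩
  · simpa using congrFun h (G.oldC m tf ε i)
  · simpa using congrFun h (G.bX m tf ε)
  · simpa using congrFun h (G.bY m tf ε)

/-- Flipping an old chord. [folklore] -/
theorem update_bigonState_oldC (σ : G.State) (a b : Bool) (i : Fin G.n) (c : Bool) :
    Function.update (G.bigonState m tf ε σ a b) (G.oldC m tf ε i) c =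
      G.bigonState m tf ε (Function.update σ i c) a b := by
  funext j
  rw [Function.update_apply]
  rcases G.eq_oldC_or_bX_or_bY m tf ε j with ⟨i', rfl⟩ | rfl | rfl
  · rw [bigonState_oldC, bigonState_oldC, Function.update_apply]
    simp only [oldC_inj]
  · rw [bigonState_bX, bigonState_bX, if_neg (G.oldC_ne_bX m tf ε i).symm]
  · rw [bigonState_bY, bigonState_bY, if_neg (G.oldC_ne_bY m tf ε i).symm]

/-- Flipping `x`. [folklore] -/
theorem update_bigonState_bX (σ : G.State) (a b c : Bool) :
    Function.update (G.bigonState m tf ε σ a b) (G.bX m tf ε) c = G.bigonState m tf ε σ c b := by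
  funext j
  rw [Function.update_apply]
  rcases G.eq_oldC_or_bX_or_bY m tf ε j with ⟨i', rfl⟩ | rfl | rfl
  · rw [bigonState_oldC, bigonState_oldC, if_neg (G.oldC_ne_bX m tf ε i')]
  · rw [bigonState_bX, bigonState_bX, if_pos rfl]
  · rw [bigonState_bY, bigonState_bY, if_neg (G.bX_ne_bY m tf ε).symm]

/-- Flipping `y`. [folklore] -/
theorem update_bigonState_bY (σ : G.State) (a b c : Bool) :
    Function.update (G.bigonState m tf ε σ a b) (G.bY m tf ε) c = G.bigonState m tf ε σ a c := by
  funext j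
  rw [Function.update_apply]
  rcases G.eq_oldC_or_bX_or_bY m tf ε j with ⟨i', rfl⟩ | rfl | rfl
  · rw [bigonState_oldC, bigonState_oldC, if_neg (G.oldC_ne_bY m tf ε i')]
  · rw [bigonState_bX, bigonState_bX, if_neg (G.bX_ne_bY m tf ε)]
  · rw [bigonState_bY, bigonState_bY, if_pos rfl]

/-- The Seifert rule at an old chord is the old one. [folklore] -/
@[simp] theorem isSeifert_bigon_oldC (σ : G.State) (a b : Bool) (i : Fin G.n) :
    (G.bigon m tf ε).isSeifert (G.bigonState m tf ε σ a b) (G.oldC m tf ε i) = G.isSeifert σ i := by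
  simp [isSeifert]

/-- The Seifert rule at `x` (sign `ε`): the `0`-smoothing is Seifert's iff `ε = 1`. [folklore] -/
theorem isSeifert_bigon_bX (σ : G.State) (a b : Bool) :
    (G.bigon m tf ε).isSeifert (G.bigonState m tf ε σ a b) (G.bX m tf ε) =
      ((a == false) == (ε == 1)) := by
  simp [isSeifert]

/-- The Seifert rule at `y` (sign `-ε`): the `0`-smoothing is Seifert's iff `ε = -1`. [folklore] -/
theorem isSeifert_bigon_bY (σ : G.State) (a b : Bool) :
    (G.bigon m tf ε).isSeifert (G.bigonState m tf ε σ a b) (G.bY m tf ε) =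
      ((b == false) == (ε == -1)) := by
  have : (-ε == 1) = (ε == -1) := by
    rcases Int.units_eq_one_or ε with rfl | rfl <;> decide
  simp [isSeifert, this]

/-- The weight of a state of the bigon. [folklore] -/
theorem weight_bigonState (σ : G.State) (a b : Bool) :
    (G.bigonState m tf ε σ a b).weight =
      σ.weight + (if a then 1 else 0) + (if b then 1 else 0) := by
  have h1 : (G.bigonState m tf ε σ a b).weight =
      State.weight (G := G.bigonMid m tf ε) (Fin.snoc σ a) + (if b then 1 else 0) :=
    (G.bigonMid m tf ε).weight_snoc _ _ (-ε) (Fin.snoc σ a) b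
  have h2 : State.weight (G := G.bigonMid m tf ε) (Fin.snoc σ a) =
      σ.weight + (if a then 1 else 0) :=
    G.weight_snoc _ _ ε σ a
  rw [h1, h2]

/-- The bigon has one more positive crossing. [folklore] -/
theorem nPlus_bigon : (G.bigon m tf ε).nPlus = G.nPlus + 1 := by
  have h1 : (G.bigon m tf ε).nPlus = (G.bigonMid m tf ε).nPlus + if -ε = 1 then 1 else 0 :=
    (G.bigonMid m tf ε).nPlus_insertChord _ _ (-ε)
  have h2 : (G.bigonMid m tf ε).nPlus = G.nPlus + if ε = 1 then 1 else 0 :=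
    G.nPlus_insertChord _ _ ε
  rw [h1, h2]
  rcases Int.units_eq_one_or ε with rfl | rfl <;> simp

/-- The bigon has one more negative crossing. [folklore] -/
theorem nMinus_bigon : (G.bigon m tf ε).nMinus = G.nMinus + 1 := by
  have h1 : (G.bigon m tf ε).nMinus = (G.bigonMid m tf ε).nMinus + if -ε = -1 then 1 else 0 :=
    (G.bigonMid m tf ε).nMinus_insertChord _ _ (-ε)
  have h2 : (G.bigonMid m tf ε).nMinus = G.nMinus + if ε = -1 then 1 else 0 :=
    G.nMinus_insertChord _ _ ε
  rw [h1, h2]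
  rcases Int.units_eq_one_or ε with rfl | rfl <;> simp

/-- **Old chords keep their Koszul signs.** Khovanov (2000), §3.3. [cite: Khovanov2000, §3.3] -/
theorem edgeSign_bigonState_oldC (σ : G.State) (a b : Bool) (i : Fin G.n) :
    edgeSign (G.bigonState m tf ε σ a b) (G.oldC m tf ε i) = edgeSign σ i := by
  have h1 : edgeSign (G.bigonState m tf ε σ a b) (G.oldC m tf ε i) =
      edgeSign (G := G.bigonMid m tf ε) (Fin.snoc σ a) i.castSucc :=
    (G.bigonMid m tf ε).edgeSign_snoc_castSucc _ _ (-ε) (Fin.snoc σ a) b i.castSucc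
  have h2 : edgeSign (G := G.bigonMid m tf ε) (Fin.snoc σ a) i.castSucc = edgeSign σ i :=
    G.edgeSign_snoc_castSucc _ _ ε σ a i
  rw [h1, h2]

/-- **The Koszul sign of `x` is `(-1)^{|σ|}`.** Khovanov (2000), §3.3. [cite: Khovanov2000, §3.3] -/
theorem edgeSign_bigonState_bX (σ : G.State) (a b : Bool) :
    edgeSign (G.bigonState m tf ε σ a b) (G.bX m tf ε) = (-1) ^ σ.weight := by
  have h1 : edgeSign (G.bigonState m tf ε σ a b) (G.bX m tf ε) =
      edgeSign (G := G.bigonMid m tf ε) (Fin.snoc σ a) (Fin.last G.n) :=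
    (G.bigonMid m tf ε).edgeSign_snoc_castSucc _ _ (-ε) (Fin.snoc σ a) b (Fin.last G.n)
  have h2 : edgeSign (G := G.bigonMid m tf ε) (Fin.snoc σ a) (Fin.last G.n) = (-1) ^ σ.weight :=
    G.edgeSign_snoc_last _ _ ε σ a
  rw [h1, h2]

/-- **The Koszul sign of `y` is `(-1)^{|σ| + a}`.** Khovanov (2000), §3.3.
[cite: Khovanov2000, §3.3] -/
theorem edgeSign_bigonState_bY (σ : G.State) (a b : Bool) :
    edgeSign (G.bigonState m tf ε σ a b) (G.bY m tf ε) =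
      (-1) ^ (σ.weight + if a then 1 else 0) := by
  have h1 : edgeSign (G.bigonState m tf ε σ a b) (G.bY m tf ε) =
      (-1) ^ State.weight (G := G.bigonMid m tf ε) (Fin.snoc σ a) :=
    (G.bigonMid m tf ε).edgeSign_snoc_last _ _ (-ε) (Fin.snoc σ a) b
  have h2 : State.weight (G := G.bigonMid m tf ε) (Fin.snoc σ a) =
      σ.weight + (if a then 1 else 0) :=
    G.weight_snoc _ _ ε σ a
  rw [h1, h2]

/-! ## Arcs around the new points -/

/-- The bigon has `2n + 4` arcs. [folklore] -/
theorem arcCount_bigon : (G.bigon m tf ε).arcCount = 2 * G.n + 4 := by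
  show max (2 * (G.n + 2)) 1 = 2 * G.n + 4
  omega

/-- **The first side of the bigon**: the arc from `m` to `m + 1`. Khovanov (2000), §5.3.
[cite: Khovanov2000, §5.3] -/
def sideM : (G.bigon m tf ε).Arc := (G.bigon m tf ε).arcOut (G.posM m tf ε)

/-- **The second side of the bigon**: the arc from `2n + 2` to `2n + 3`. Khovanov (2000), §5.3.
[cite: Khovanov2000, §5.3] -/
def sideE : (G.bigon m tf ε).Arc := (G.bigon m tf ε).arcOut (G.posE m tf ε)

/-- The arc entering `m`. [folklore] -/
def inM : (G.bigon m tf ε).Arc := (G.bigon m tf ε).arcIn (G.posM m tf ε)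

/-- The arc leaving `m + 1`. [folklore] -/
def outM1 : (G.bigon m tf ε).Arc := (G.bigon m tf ε).arcOut (G.posM1 m tf ε)

/-- The arc entering `2n + 2` (number `2n + 1`). [folklore] -/
def inE : (G.bigon m tf ε).Arc := (G.bigon m tf ε).arcIn (G.posE m tf ε)

/-- The arc leaving `2n + 3` (number `2n + 3`, through the base point). [folklore] -/
def outE1 : (G.bigon m tf ε).Arc := (G.bigon m tf ε).arcOut (G.posE1 m tf ε)

/-- The number of the first side. [folklore] -/
@[simp] theorem val_sideM : (G.sideM m tf ε : ℕ) = m.val := rfl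
/-- The number of the second side. [folklore] -/
@[simp] theorem val_sideE : (G.sideE m tf ε : ℕ) = 2 * G.n + 2 := rfl
/-- The number of the arc leaving `m + 1`. [folklore] -/
@[simp] theorem val_outM1 : (G.outM1 m tf ε : ℕ) = m.val + 1 := rfl
/-- The number of the arc leaving `2n + 3`. [folklore] -/
@[simp] theorem val_outE1 : (G.outE1 m tf ε : ℕ) = 2 * G.n + 3 := rfl

/-- The number of the arc entering `2n + 2`. [folklore] -/
@[simp] theorem val_inE : (G.inE m tf ε : ℕ) = 2 * G.n + 1 := by
  unfold inE; rw [arcIn_val]; simp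

/-- The number of the arc entering `m`: `m - 1`, or `2n + 3` if `m = 0`. [folklore] -/
theorem val_inM : (G.inM m tf ε : ℕ) = if m.val = 0 then 2 * G.n + 3 else m.val - 1 := by
  unfold inM; rw [arcIn_val]; simp only [val_posM, bigon_n]; split_ifs <;> omega

/-- The arc entering `m + 1` is the first side. [folklore] -/
@[simp] theorem arcIn_posM1 : (G.bigon m tf ε).arcIn (G.posM1 m tf ε) = G.sideM m tf ε := by
  apply Fin.ext; rw [arcIn_val]; simp

/-- The arc entering `2n + 3` is the second side. [folklore] -/
@[simp] theorem arcIn_posE1 : (G.bigon m tf ε).arcIn (G.posE1 m tf ε) = G.sideE m tf ε := by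
  apply Fin.ext; rw [arcIn_val]; simp

/-- The number of the arc leaving an embedded old point. [folklore] -/
@[simp] theorem val_arcOut_bEmb (q : Fin (2 * G.n)) :
    ((G.bigon m tf ε).arcOut (G.bEmb m tf ε q) : ℕ) = if q.val < m.val then q.val else q.val + 2 :=
  rfl

/-- The number of the arc entering an embedded old point. [folklore] -/
theorem val_arcIn_bEmb (q : Fin (2 * G.n)) :
    ((G.bigon m tf ε).arcIn (G.bEmb m tf ε q) : ℕ) =
      if q.val < m.val then (if q.val = 0 then 2 * G.n + 3 else q.val - 1) else q.val + 1 := by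
  rw [arcIn_val, val_bEmb, bigon_n]
  have hq := q.isLt
  have hm := m.isLt
  by_cases h1 : q.val < m.val
  · rw [if_pos h1, if_pos h1]
    by_cases h2 : q.val = 0
    · rw [if_pos h2, if_pos h2]
      omega
    · rw [if_neg h2, if_neg h2]
  · rw [if_neg h1, if_neg h1, if_neg (show ¬ (q.val + 2 = 0) by omega)]
    omega

/-- **Membership in the small circle**: being one of the two sides of the bigon. [folklore] -/
def InO (a : (G.bigon m tf ε).Arc) : Prop := a = G.sideM m tf ε ∨ a = G.sideE m tf ε

/-- The first side is a side. [folklore] -/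
theorem inO_sideM : G.InO m tf ε (G.sideM m tf ε) := Or.inl rfl
/-- The second side is a side. [folklore] -/
theorem inO_sideE : G.InO m tf ε (G.sideE m tf ε) := Or.inr rfl

/-- `InO` read on numbers. [folklore] -/
theorem inO_iff (a : (G.bigon m tf ε).Arc) :
    G.InO m tf ε a ↔ a.val = m.val ∨ a.val = 2 * G.n + 2 := by
  unfold InO
  rw [Fin.ext_iff, Fin.ext_iff]
  rfl

/-- The arc entering `m` is not a side of the bigon. [folklore] -/
theorem not_inO_inM : ¬ G.InO m tf ε (G.inM m tf ε) := by
  rw [inO_iff, val_inM]; have := m.isLt; split_ifs <;> omega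

/-- The arc entering `2n + 2` is not a side of the bigon. [folklore] -/
theorem not_inO_inE : ¬ G.InO m tf ε (G.inE m tf ε) := by
  rw [inO_iff, val_inE]; have := m.isLt; omega

/-- The arc leaving `m + 1` is not a side of the bigon. [folklore] -/
theorem not_inO_outM1 : ¬ G.InO m tf ε (G.outM1 m tf ε) := by
  rw [inO_iff, val_outM1]; have := m.isLt; omega

/-- The arc leaving `2n + 3` is not a side of the bigon. [folklore] -/
theorem not_inO_outE1 : ¬ G.InO m tf ε (G.outE1 m tf ε) := by
  rw [inO_iff, val_outE1]; have := m.isLt; omega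

/-- An arc leaving an old point is not a side of the bigon. [folklore] -/
theorem not_inO_arcOut_bEmb (q : Fin (2 * G.n)) :
    ¬ G.InO m tf ε ((G.bigon m tf ε).arcOut (G.bEmb m tf ε q)) := by
  rw [inO_iff, val_arcOut_bEmb]; have := m.isLt; have := q.isLt; split_ifs <;> omega

/-- An arc entering an old point is not a side of the bigon. [folklore] -/
theorem not_inO_arcIn_bEmb (q : Fin (2 * G.n)) :
    ¬ G.InO m tf ε ((G.bigon m tf ε).arcIn (G.bEmb m tf ε q)) := by
  rw [inO_iff, val_arcIn_bEmb]; have := m.isLt; have := q.isLt; split_ifs <;> omega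

/-- The two sides are distinct arcs. [folklore] -/
theorem sideM_ne_sideE : G.sideM m tf ε ≠ G.sideE m tf ε := fun h ↦ by
  have := congrArg Fin.val h; simp at this; have := m.isLt; omega

/-- The two local strands at `x` (`arcIn (overPos x)`, `arcOut (overPos x)`): the first is off
the small circle, the second on it. [folklore] -/
theorem inO_strands_bX :
    ¬ G.InO m tf ε ((G.bigon m tf ε).arcIn ((G.bigon m tf ε).overPos (G.bX m tf ε))) ∧
      G.InO m tf ε ((G.bigon m tf ε).arcOut ((G.bigon m tf ε).overPos (G.bX m tf ε))) := by
  rw [overPos_bigon_bX]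
  cases tf
  · exact ⟨G.not_inO_inE m false ε, G.inO_sideE m false ε⟩
  · exact ⟨G.not_inO_inM m true ε, G.inO_sideM m true ε⟩

/-- The two local strands at `y`: the first is on the small circle, the second off it.
[folklore] -/
theorem inO_strands_bY :
    G.InO m tf ε ((G.bigon m tf ε).arcIn ((G.bigon m tf ε).overPos (G.bY m tf ε))) ∧
      ¬ G.InO m tf ε ((G.bigon m tf ε).arcOut ((G.bigon m tf ε).overPos (G.bY m tf ε))) := by
  rw [overPos_bigon_bY]
  cases tf
  · simp only [Bool.false_eq_true, if_false, arcIn_posE1]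
    exact ⟨G.inO_sideE m false ε, G.not_inO_outE1 m false ε⟩
  · simp only [if_true, arcIn_posM1]
    exact ⟨G.inO_sideM m true ε, G.not_inO_outM1 m true ε⟩

/-! ## The gluing clauses at the four new points -/

section Glue

variable (τ : (G.bigon m tf ε).State)

/-- The gluing clause at `m`. [folklore] -/
theorem glueRel_posM (u v : (G.bigon m tf ε).Arc) :
    (G.bigon m tf ε).glueRel τ (G.posM m tf ε) u v ↔
      ((G.bigon m tf ε).isSeifert τ (G.bX m tf ε) = true ∧
          ((u = G.inM m tf ε ∧ v = G.sideE m tf ε) ∨ (v = G.inM m tf ε ∧ u = G.sideE m tf ε))) ∨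
        ((G.bigon m tf ε).isSeifert τ (G.bX m tf ε) = false ∧
          ((u = G.inM m tf ε ∧ v = G.inE m tf ε) ∨ (u = G.sideM m tf ε ∧ v = G.sideE m tf ε))) := by
  simp only [glueRel, chordOf_posM, partner_posM]
  rfl

/-- The gluing clause at `2n + 2`. [folklore] -/
theorem glueRel_posE (u v : (G.bigon m tf ε).Arc) :
    (G.bigon m tf ε).glueRel τ (G.posE m tf ε) u v ↔
      ((G.bigon m tf ε).isSeifert τ (G.bX m tf ε) = true ∧
          ((u = G.inE m tf ε ∧ v = G.sideM m tf ε) ∨ (v = G.inE m tf ε ∧ u = G.sideM m tf ε))) ∨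
        ((G.bigon m tf ε).isSeifert τ (G.bX m tf ε) = false ∧
          ((u = G.inE m tf ε ∧ v = G.inM m tf ε) ∨ (u = G.sideE m tf ε ∧ v = G.sideM m tf ε))) := by
  simp only [glueRel, chordOf_posE, partner_posE]
  rfl

/-- The gluing clause at `m + 1`. [folklore] -/
theorem glueRel_posM1 (u v : (G.bigon m tf ε).Arc) :
    (G.bigon m tf ε).glueRel τ (G.posM1 m tf ε) u v ↔
      ((G.bigon m tf ε).isSeifert τ (G.bY m tf ε) = true ∧
          ((u = G.sideM m tf ε ∧ v = G.outE1 m tf ε) ∨ (v = G.sideM m tf ε ∧ u = G.outE1 m tf ε))) ∨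
        ((G.bigon m tf ε).isSeifert τ (G.bY m tf ε) = false ∧
          ((u = G.sideM m tf ε ∧ v = G.sideE m tf ε) ∨
            (u = G.outM1 m tf ε ∧ v = G.outE1 m tf ε))) := by
  simp only [glueRel, chordOf_posM1, partner_posM1, arcIn_posM1, arcIn_posE1]
  rfl

/-- The gluing clause at `2n + 3`. [folklore] -/
theorem glueRel_posE1 (u v : (G.bigon m tf ε).Arc) :
    (G.bigon m tf ε).glueRel τ (G.posE1 m tf ε) u v ↔
      ((G.bigon m tf ε).isSeifert τ (G.bY m tf ε) = true ∧
          ((u = G.sideE m tf ε ∧ v = G.outM1 m tf ε) ∨ (v = G.sideE m tf ε ∧ u = G.outM1 m tf ε))) ∨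
        ((G.bigon m tf ε).isSeifert τ (G.bY m tf ε) = false ∧
          ((u = G.sideE m tf ε ∧ v = G.sideM m tf ε) ∨
            (u = G.outE1 m tf ε ∧ v = G.outM1 m tf ε))) := by
  simp only [glueRel, chordOf_posE1, partner_posE1, arcIn_posM1, arcIn_posE1]
  rfl

/-- A gluing at an old point does not involve the sides of the bigon. [folklore] -/
theorem not_inO_of_glueRel_bEmb {q : Fin (2 * G.n)} {u v : (G.bigon m tf ε).Arc}
    (h : (G.bigon m tf ε).glueRel τ (G.bEmb m tf ε q) u v) :
    ¬ G.InO m tf ε u ∧ ¬ G.InO m tf ε v := by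
  unfold glueRel at h
  rw [partner_bEmb] at h
  rcases h with ⟨-, ⟨rfl, rfl⟩ | ⟨rfl, rfl⟩⟩ | ⟨-, ⟨rfl, rfl⟩ | ⟨rfl, rfl⟩⟩
  · exact ⟨G.not_inO_arcIn_bEmb m tf ε _, G.not_inO_arcOut_bEmb m tf ε _⟩
  · exact ⟨G.not_inO_arcOut_bEmb m tf ε _, G.not_inO_arcIn_bEmb m tf ε _⟩
  · exact ⟨G.not_inO_arcIn_bEmb m tf ε _, G.not_inO_arcIn_bEmb m tf ε _⟩
  · exact ⟨G.not_inO_arcOut_bEmb m tf ε _, G.not_inO_arcOut_bEmb m tf ε _⟩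

variable {τ}
variable (hx : (G.bigon m tf ε).isSeifert τ (G.bX m tf ε) = false)
  (hy : (G.bigon m tf ε).isSeifert τ (G.bY m tf ε) = false)

include hx hy in
/-- When neither new chord is smoothed à la Seifert, a gluing relates two arcs of the small
circle or two arcs off it. [folklore] -/
theorem inO_iff_of_glueRel {p : Fin (2 * (G.bigon m tf ε).n)} {u v : (G.bigon m tf ε).Arc}
    (h : (G.bigon m tf ε).glueRel τ p u v) : G.InO m tf ε u ↔ G.InO m tf ε v := by
  rcases G.eq_bEmb_or m tf ε p with ⟨q, rfl⟩ | rfl | rfl | rfl | rfl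
  · obtain ⟨hu, hv⟩ := G.not_inO_of_glueRel_bEmb m tf ε τ h
    exact ⟨fun h' ↦ (hu h').elim, fun h' ↦ (hv h').elim⟩
  · rw [glueRel_posM, hx] at h
    rcases h with ⟨h', -⟩ | ⟨-, ⟨rfl, rfl⟩ | ⟨rfl, rfl⟩⟩
    · exact (Bool.false_ne_true h').elim
    · exact ⟨fun h' ↦ (G.not_inO_inM m tf ε h').elim, fun h' ↦ (G.not_inO_inE m tf ε h').elim⟩
    · exact ⟨fun _ ↦ G.inO_sideE m tf ε, fun _ ↦ G.inO_sideM m tf ε⟩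
  · rw [glueRel_posM1, hy] at h
    rcases h with ⟨h', -⟩ | ⟨-, ⟨rfl, rfl⟩ | ⟨rfl, rfl⟩⟩
    · exact (Bool.false_ne_true h').elim
    · exact ⟨fun _ ↦ G.inO_sideE m tf ε, fun _ ↦ G.inO_sideM m tf ε⟩
    · exact ⟨fun h' ↦ (G.not_inO_outM1 m tf ε h').elim,
        fun h' ↦ (G.not_inO_outE1 m tf ε h').elim⟩
  · rw [glueRel_posE, hx] at h
    rcases h with ⟨h', -⟩ | ⟨-, ⟨rfl, rfl⟩ | ⟨rfl, rfl⟩⟩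
    · exact (Bool.false_ne_true h').elim
    · exact ⟨fun h' ↦ (G.not_inO_inE m tf ε h').elim, fun h' ↦ (G.not_inO_inM m tf ε h').elim⟩
    · exact ⟨fun _ ↦ G.inO_sideM m tf ε, fun _ ↦ G.inO_sideE m tf ε⟩
  · rw [glueRel_posE1, hy] at h
    rcases h with ⟨h', -⟩ | ⟨-, ⟨rfl, rfl⟩ | ⟨rfl, rfl⟩⟩
    · exact (Bool.false_ne_true h').elim
    · exact ⟨fun _ ↦ G.inO_sideM m tf ε, fun _ ↦ G.inO_sideE m tf ε⟩
    · exact ⟨fun h' ↦ (G.not_inO_outE1 m tf ε h').elim,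
        fun h' ↦ (G.not_inO_outM1 m tf ε h').elim⟩

include hx hy in
/-- **The small circle is a union of state circles** when neither new chord is smoothed à la
Seifert: adjacency in the state graph preserves membership in `{sideM, sideE}`.
Khovanov (2000), §5.3; Bar-Natan (2002), §4.3. [cite: Khovanov2000, §5.3] -/
theorem inO_iff_of_adj {u v : (G.bigon m tf ε).Arc} (h : ((G.bigon m tf ε).stateGraph τ).Adj u v) :
    G.InO m tf ε u ↔ G.InO m tf ε v := by
  rw [stateGraph_adj] at h
  obtain ⟨-, p, hp | hp⟩ := h
  · exact G.inO_iff_of_glueRel m tf ε hx hy hp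
  · exact (G.inO_iff_of_glueRel m tf ε hx hy hp).symm

include hx hy in
/-- Reachability preserves membership in the small circle (neither new chord Seifert). [folklore] -/
theorem inO_iff_of_reachable {u v : (G.bigon m tf ε).Arc}
    (h : ((G.bigon m tf ε).stateGraph τ).Reachable u v) : G.InO m tf ε u ↔ G.InO m tf ε v := by
  obtain ⟨w⟩ := h
  induction w with
  | nil => rfl
  | cons hadj _ ih => exact (G.inO_iff_of_adj m tf ε hx hy hadj).trans ih

include hx in
/-- **The two sides of the bigon are glued to each other** when `x` is not smoothed à la
Seifert. [folklore] -/
theorem adj_sideM_sideE : ((G.bigon m tf ε).stateGraph τ).Adj (G.sideM m tf ε) (G.sideE m tf ε) := by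
  rw [stateGraph_adj]
  exact ⟨G.sideM_ne_sideE m tf ε, G.posM m tf ε,
    Or.inl ((G.glueRel_posM m tf ε τ _ _).2 (Or.inr ⟨hx, Or.inr ⟨rfl, rfl⟩⟩))⟩

include hx hy in
/-- **The small circle is exactly one state circle** (neither new chord Seifert): an arc lies on
the circle of `sideM` iff it is a side of the bigon. Khovanov (2000), §5.3. [cite: Khovanov2000, §5.3] -/
theorem circleOf_eq_circleOf_sideM_iff (u : (G.bigon m tf ε).Arc) :
    (G.bigon m tf ε).circleOf τ u = (G.bigon m tf ε).circleOf τ (G.sideM m tf ε) ↔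
      G.InO m tf ε u := by
  rw [circleOf, circleOf, SimpleGraph.ConnectedComponent.eq]
  constructor
  · intro h
    exact (G.inO_iff_of_reachable m tf ε hx hy h).2 (G.inO_sideM m tf ε)
  · rintro (rfl | rfl)
    · rfl
    · exact (G.adj_sideM_sideE m tf ε hx).reachable.symm

end Glue

/-! ## The four resolutions of the new chords -/

/-- The smoothing of `x` in the resolution where the *positive* new chord is flipped: `1` iff
`ε = 1`. [folklore] -/
def oBitX : Bool := decide (ε = 1)

/-- The smoothing of `y` in that resolution: `1` iff `ε = -1`. [folklore] -/
def oBitY : Bool := !decide (ε = 1)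

/-- **The all-`0` resolution** of the two new chords over the old state `σ` (the source corner
of the square of `x, y`). [folklore] -/
def stA (σ : G.State) : (G.bigon m tf ε).State := G.bigonState m tf ε σ false false

/-- **The resolution with the small circle**: the positive new chord flipped (neither new chord
smoothed à la Seifert; `D ⊔ O` of Khovanov (2000), §5.3). [cite: Khovanov2000, §5.3] -/
def stO (σ : G.State) : (G.bigon m tf ε).State :=
  G.bigonState m tf ε σ (oBitX ε) (oBitY ε)

/-- **The all-`1` resolution** of the two new chords. [folklore] -/
def stU (σ : G.State) : (G.bigon m tf ε).State := G.bigonState m tf ε σ true true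

/-- **The oriented resolution** of the two new chords: the negative one flipped (both new chords
smoothed à la Seifert; the corner isomorphic to `C(D)`). Khovanov (2000), §5.3. [cite: Khovanov2000, §5.3] -/
def stD (σ : G.State) : (G.bigon m tf ε).State :=
  G.bigonState m tf ε σ (oBitY ε) (oBitX ε)

/-- **The positive new chord** `f` (flipped first: `stA → stO`): `x` if `ε = 1`, `y` otherwise.
[folklore] -/
def fC : Fin (G.bigon m tf ε).n := if ε = 1 then G.bX m tf ε else G.bY m tf ε

/-- **The negative new chord** `g` (flipped second: `stO → stU`): `y` if `ε = 1`, `x` otherwise.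
[folklore] -/
def gC : Fin (G.bigon m tf ε).n := if ε = 1 then G.bY m tf ε else G.bX m tf ε

variable (σ : G.State)

/-- `f` is `0`-smoothed in the all-`0` resolution. [folklore] -/
theorem stA_fC : G.stA m tf ε σ (G.fC m tf ε) = false := by
  unfold stA fC; split_ifs <;> simp

/-- `g` is `0`-smoothed in the all-`0` resolution. [folklore] -/
theorem stA_gC : G.stA m tf ε σ (G.gC m tf ε) = false := by
  unfold stA gC; split_ifs <;> simp

/-- `g` is `0`-smoothed in the resolution with the small circle. [folklore] -/
theorem stO_gC : G.stO m tf ε σ (G.gC m tf ε) = false := by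
  unfold stO gC oBitX oBitY; split_ifs with h <;> simp [h]

/-- `f` is `1`-smoothed in the resolution with the small circle. [folklore] -/
theorem stO_fC : G.stO m tf ε σ (G.fC m tf ε) = true := by
  unfold stO fC oBitX oBitY; split_ifs with h <;> simp [h]

/-- Flipping `f` from the all-`0` resolution gives the resolution with the small circle. [folklore] -/
theorem update_stA_fC : Function.update (G.stA m tf ε σ) (G.fC m tf ε) true = G.stO m tf ε σ := by
  unfold stA stO fC oBitX oBitY
  split_ifs with h
  · rw [update_bigonState_bX]; simp [h]
  · rw [update_bigonState_bY]; simp [h]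

/-- Flipping `g` from the resolution with the small circle gives the all-`1` resolution. [folklore] -/
theorem update_stO_gC : Function.update (G.stO m tf ε σ) (G.gC m tf ε) true = G.stU m tf ε σ := by
  unfold stO stU gC oBitX oBitY
  split_ifs with h
  · rw [update_bigonState_bY]; simp [h]
  · rw [update_bigonState_bX]; simp [h]

/-- Flipping `g` from the all-`0` resolution gives the oriented resolution. [folklore] -/
theorem update_stA_gC : Function.update (G.stA m tf ε σ) (G.gC m tf ε) true = G.stD m tf ε σ := by
  unfold stA stD gC oBitX oBitY
  split_ifs with h
  · rw [update_bigonState_bY]; simp [h]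
  · rw [update_bigonState_bX]; simp [h]

/-- Flipping `f` from the oriented resolution gives the all-`1` resolution. [folklore] -/
theorem update_stD_fC : Function.update (G.stD m tf ε σ) (G.fC m tf ε) true = G.stU m tf ε σ := by
  unfold stD stU fC oBitX oBitY
  split_ifs with h
  · rw [update_bigonState_bX]; simp [h]
  · rw [update_bigonState_bY]; simp [h]

/-- In the resolution with the small circle, `x` is not smoothed à la Seifert. [folklore] -/
theorem isSeifert_stO_bX : (G.bigon m tf ε).isSeifert (G.stO m tf ε σ) (G.bX m tf ε) = false := by
  unfold stO oBitX
  rw [isSeifert_bigon_bX]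
  rcases Int.units_eq_one_or ε with rfl | rfl <;> decide

/-- In the resolution with the small circle, `y` is not smoothed à la Seifert. [folklore] -/
theorem isSeifert_stO_bY : (G.bigon m tf ε).isSeifert (G.stO m tf ε σ) (G.bY m tf ε) = false := by
  unfold stO oBitY
  rw [isSeifert_bigon_bY]
  rcases Int.units_eq_one_or ε with rfl | rfl <;> decide

/-- In the oriented resolution, `x` is smoothed à la Seifert. [folklore] -/
theorem isSeifert_stD_bX : (G.bigon m tf ε).isSeifert (G.stD m tf ε σ) (G.bX m tf ε) = true := by
  unfold stD oBitY
  rw [isSeifert_bigon_bX]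
  rcases Int.units_eq_one_or ε with rfl | rfl <;> decide

/-- In the oriented resolution, `y` is smoothed à la Seifert. [folklore] -/
theorem isSeifert_stD_bY : (G.bigon m tf ε).isSeifert (G.stD m tf ε σ) (G.bY m tf ε) = true := by
  unfold stD oBitX
  rw [isSeifert_bigon_bY]
  rcases Int.units_eq_one_or ε with rfl | rfl <;> decide

/-- **The strand of `f` on the small circle and the strand off it.** Exactly one of the two local
strands `arcIn (overPos f)`, `arcOut (overPos f)` is a side of the bigon. [folklore] -/
theorem inO_strands_fC :
    (¬ G.InO m tf ε ((G.bigon m tf ε).arcIn ((G.bigon m tf ε).overPos (G.fC m tf ε))) ∧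
        G.InO m tf ε ((G.bigon m tf ε).arcOut ((G.bigon m tf ε).overPos (G.fC m tf ε)))) ∨
      (G.InO m tf ε ((G.bigon m tf ε).arcIn ((G.bigon m tf ε).overPos (G.fC m tf ε))) ∧
        ¬ G.InO m tf ε ((G.bigon m tf ε).arcOut ((G.bigon m tf ε).overPos (G.fC m tf ε)))) := by
  unfold fC
  split_ifs
  · exact Or.inl (G.inO_strands_bX m tf ε)
  · exact Or.inr (G.inO_strands_bY m tf ε)

/-- Exactly one of the two local strands of `g` is a side of the bigon. [folklore] -/
theorem inO_strands_gC :
    (¬ G.InO m tf ε ((G.bigon m tf ε).arcIn ((G.bigon m tf ε).overPos (G.gC m tf ε))) ∧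
        G.InO m tf ε ((G.bigon m tf ε).arcOut ((G.bigon m tf ε).overPos (G.gC m tf ε)))) ∨
      (G.InO m tf ε ((G.bigon m tf ε).arcIn ((G.bigon m tf ε).overPos (G.gC m tf ε))) ∧
        ¬ G.InO m tf ε ((G.bigon m tf ε).arcOut ((G.bigon m tf ε).overPos (G.gC m tf ε)))) := by
  unfold gC
  split_ifs
  · exact Or.inr (G.inO_strands_bY m tf ε)
  · exact Or.inl (G.inO_strands_bX m tf ε)

/-- In the resolution with the small circle, the two local strands of a new chord lie on
different circles (one on the small circle, one off it). [folklore] -/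
theorem circleOf_stO_strands_ne {a b : (G.bigon m tf ε).Arc}
    (hab : (¬ G.InO m tf ε a ∧ G.InO m tf ε b) ∨ (G.InO m tf ε a ∧ ¬ G.InO m tf ε b)) :
    (G.bigon m tf ε).circleOf (G.stO m tf ε σ) a ≠ (G.bigon m tf ε).circleOf (G.stO m tf ε σ) b := by
  intro h
  rw [circleOf, circleOf, SimpleGraph.ConnectedComponent.eq] at h
  have key := G.inO_iff_of_reachable m tf ε (G.isSeifert_stO_bX m tf ε σ)
    (G.isSeifert_stO_bY m tf ε σ) h
  rcases hab with ⟨ha, hb⟩ | ⟨ha, hb⟩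
  · exact ha (key.2 hb)
  · exact hb (key.1 ha)

/-- **Flipping the positive new chord from the all-`0` resolution is a split** (it splits off
the small circle), for every Gauss diagram and every old state. Khovanov (2000), §5.3;
Bar-Natan (2002), §4.3. [cite: Khovanov2000, §5.3] -/
theorem isSplitAt_stA : (G.bigon m tf ε).IsSplitAt (G.stA m tf ε σ) (G.fC m tf ε) := by
  refine ⟨G.stA_fC m tf ε σ, ?_⟩
  rw [update_stA_fC]
  exact G.circleOf_stO_strands_ne m tf ε σ (G.inO_strands_fC m tf ε)

/-- **Flipping the negative new chord from the resolution with the small circle is a merge**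
(it merges the small circle back), for every Gauss diagram and every old state.
Khovanov (2000), §5.3; Bar-Natan (2002), §4.3. [cite: Khovanov2000, §5.3] -/
theorem isMergeAt_stO : (G.bigon m tf ε).IsMergeAt (G.stO m tf ε σ) (G.gC m tf ε) :=
  ⟨G.stO_gC m tf ε σ, G.circleOf_stO_strands_ne m tf ε σ (G.inO_strands_gC m tf ε)⟩

/-- In the resolution with the small circle, an arc lies on the circle of `sideM` iff it is a
side of the bigon. [folklore] -/
theorem circleOf_stO_eq_iff (u : (G.bigon m tf ε).Arc) :
    (G.bigon m tf ε).circleOf (G.stO m tf ε σ) u =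
        (G.bigon m tf ε).circleOf (G.stO m tf ε σ) (G.sideM m tf ε) ↔ G.InO m tf ε u :=
  G.circleOf_eq_circleOf_sideM_iff m tf ε (G.isSeifert_stO_bX m tf ε σ)
    (G.isSeifert_stO_bY m tf ε σ) u

end GaussDiagram

end Literature.Topology.FourManifolds
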